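import Literature.Computability.AlgebraicComplexity.LaserMethodBlocks
import Literature.Computability.AlgebraicComplexity.LaserMethodTheorem
import Literature.Computability.AlgebraicComplexity.AsymptoticRankMultiples
import Literature.Barriers.MatrixMultiplication.UniversalMethodBarrierCor28
import HarnessLib

/-!
# Symmetrisation `t ⊗ t_C ⊗ t_{C²}` of a partitioned tensor: blocks, support, tightness
(Le Gall 2014, §2.2 and Appendix A.3) — proved

Topic `Literature/Computability/AlgebraicComplexity`.  Le Gall's value `V_ρ(t)` (ISSAC 2014,
arXiv:1401.7714, Def. 2.1) is defined through the tensor `t ⊗ t_C ⊗ t_{C²}`, `t_C, t_{C²}` the two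
cyclic rotations of the coordinates of `t` ("`V_{ρ,N}(t)` … such that `(t ⊗ t_C ⊗ t_{C²})^{⊗N}`
can be degenerated into `⊕ e ⊙ ⟨m,m,m⟩`", §2.2), and the proof of his Thm. 4.1 (the laser method
with values, Appendix A.3) runs the hashing on the decomposition of `t̄ ⊗ t̄_C ⊗ t̄_{C²}` INDUCED by a
decomposition `D` of `t` ("The decomposition of `t̄` of Eq. (4) naturally induces a decomposition of
`t̄ ⊗ t̄_C ⊗ t̄_{C²}` with support `Λ`", p. 23), whose three typed projections all have the size
`|S̄₁||S̄₂||S̄₃|` — this is what turns `min_m H(P_m)` (BCS Thm. 15.41, the tree's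
`laserMethod_hasLaserValue`) into the printed `∑_ℓ H(P_ℓ)/3`.  This file sets up that induced
decomposition in the coordinates of `LaserMethodBlocks.lean` and PROVES its structural properties:

* `symm3 t = t ⊗ rotate t ⊗ rotate (rotate t)` (`rotate` of `FlatteningBound.lean`:
  `(rotate t) b c a = t a b c`), on `(ι×κ×μ) × (κ×μ×ι) × (μ×ι×κ)`; `symm3_apply`;
  `TensorRestrictsTo.rotate`, `TensorRestrictsTo.symm3` (monotone); `kroneckerPi_symm3_eq` (the
  Kronecker product of a family of symmetrised tensors is the symmetrisation of the Kronecker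
  product, up to the canonical relabelling; both restrictions `tensorRestrictsTo_kroneckerPi_symm3`,
  `tensorRestrictsTo_symm3_kroneckerPi`); `asymptoticRank_kronecker_le` (`R̃(s ⊗ t) ≤ R̃(s) R̃(t)`)
  and `asymptoticRank_symm3_le` (`R̃(t ⊗ t_C ⊗ t_{C²}) ≤ R̃(t)³`).
* The induced decomposition: labels `symLab₁₂₃` (`x = (x₁,x₂,x₃) ↦ (bI x₁, bJ x₂, bL x₃)` etc.),
  the bijection `symLabelEquiv` between label triples of `symm3 t` and triples `(s¹, s², s³)` of
  labels of `t` (the three tensor factors), the induced support `symSupport S` (`= S × S × S` read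
  through `symLabelEquiv`; `mem_symSupport`, `symm3_support`), and its **tightness**
  (`symTight₁₂₃`: concatenate the integer vectors `(α, β, γ)`, `(β, γ, α)`, `(γ, α, β)`;
  `symTight_injective₁₂₃`, `symTight_bound₁₂₃`, `symTight_sum`): a `b`-tight `S` induces a `b`-tight
  `symSupport S`.
* `partSubtensor_symm3` — **the components of the induced decomposition are
  `t(s¹) ⊗ t(s²)_C ⊗ t(s³)_{C²}`** (Le Gall (6): "`t̂(u,v,w) = t^{⊗N}(a,b,c) ⊗ t_C^{⊗N}(b',c',a') ⊗
  t_{C²}^{⊗N}(c'',a'',b'')`", at `N = 1`).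

Everything is proved; definitions are abbreviations/plain `def`s with unfolding lemmas; no named
facts.  The entropy side (marginals of `P ⊗ P ⊗ P`, `Γ` of the induced support) is
`LaserSymmetrizationEntropy.lean`; the symmetrised laser theorem is `LaserMethodValuesSym.lean`.

## References

* F. Le Gall, *Powers of tensors and fast matrix multiplication*, ISSAC 2014, arXiv:1401.7714
  (held: `paper:arxiv-1401.7714`): §2.2 (Def. 2.1, `t ⊗ t_C ⊗ t_{C²}`), Appendix A.3, Eq. (6) and
  the definition of `Λ` (pp. 22–23). [LeGall2014]
* M. Bläser, *Fast Matrix Multiplication*, ToC Graduate Surveys 5 (2013), §5.1 (permutations of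
  tensors), Lemma 5.8. [Blaser2013]
-/

noncomputable section

open scoped BigOperators
open Finset Filter Topology

namespace Literature.Computability.AlgebraicComplexity

universe u

/-! ## The symmetrised tensor -/

section Symm3

variable {K : Type u} [CommSemiring K]
variable {ι κ μ ι' κ' μ' : Type*}

/-- **`t ⊗ t_C ⊗ t_{C²}`** (Le Gall 2014, §2.2), with `t_C = rotate t`, `t_{C²} = rotate (rotate t)`.
[cite: LeGall2014, §2.2] -/
abbrev symm3 (t : ι → κ → μ → K) : ι × κ × μ → κ × μ × ι → μ × ι × κ → K :=
  kroneckerTensor t (kroneckerTensor (rotate t) (rotate (rotate t)))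

/-- Entries of `t ⊗ t_C ⊗ t_{C²}`. [cite: LeGall2014, §2.2] -/
theorem symm3_apply (t : ι → κ → μ → K) (x : ι × κ × μ) (y : κ × μ × ι) (z : μ × ι × κ) :
    symm3 t x y z = t x.1 y.1 z.1 * (t z.2.1 x.2.1 y.2.1 * t y.2.2 z.2.2 x.2.2) := rfl

/-- Rotation commutes with Kronecker products of families (definitionally). [folklore] -/
theorem kroneckerPi_rotate {N : ℕ} (T : Fin N → ι → κ → μ → K) :
    kroneckerPi (fun q => rotate (T q)) = rotate (kroneckerPi T) := rfl

/-- `⊗_q (A_q ⊗ B_q)` is `(⊗_q A_q) ⊗ (⊗_q B_q)` read through `Equiv.arrowProdEquivProdArrow`. [folklore] -/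
theorem kroneckerPi_kronecker_eq {N : ℕ} (A : Fin N → ι → κ → μ → K) (B : Fin N → ι' → κ' → μ' → K) :
    kroneckerPi (fun q => kroneckerTensor (A q) (B q)) = fun a b c =>
      kroneckerTensor (kroneckerPi A) (kroneckerPi B)
        (Equiv.arrowProdEquivProdArrow (Fin N) (fun _ => ι) (fun _ => ι') a)
        (Equiv.arrowProdEquivProdArrow (Fin N) (fun _ => κ) (fun _ => κ') b)
        (Equiv.arrowProdEquivProdArrow (Fin N) (fun _ => μ) (fun _ => μ') c) := by
  funext a b c
  simp only [kroneckerPi_apply, kroneckerTensor_apply, Equiv.arrowProdEquivProdArrow_apply]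
  exact Finset.prod_mul_distrib

variable [Fintype ι] [Fintype κ] [Fintype μ]

/-- **Restriction commutes with rotation**: `t ≥ s ⇒ t_C ≥ s_C`. [cite: Blaser2013, §5.1] -/
theorem TensorRestrictsTo.rotate {t : ι → κ → μ → K} {s : ι' → κ' → μ' → K}
    (h : TensorRestrictsTo t s) : TensorRestrictsTo (rotate t) (rotate s) := by
  obtain ⟨A, B, C, hs⟩ := h
  refine ⟨B, C, A, fun b' c' a' => ?_⟩
  rw [rotate_apply, hs a' b' c']
  rw [Finset.sum_comm]
  refine Finset.sum_congr rfl fun b _ => ?_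
  rw [Finset.sum_comm]
  refine Finset.sum_congr rfl fun c _ => Finset.sum_congr rfl fun a _ => ?_
  rw [rotate_apply]; ring

variable [Fintype ι'] [Fintype κ'] [Fintype μ']

omit [Fintype ι'] [Fintype κ'] [Fintype μ'] in
/-- **Symmetrisation is monotone**: `t ≥ s ⇒ t ⊗ t_C ⊗ t_{C²} ≥ s ⊗ s_C ⊗ s_{C²}`.
[cite: LeGall2014, §2.2] -/
theorem TensorRestrictsTo.symm3 {t : ι → κ → μ → K} {s : ι' → κ' → μ' → K}
    (h : TensorRestrictsTo t s) : TensorRestrictsTo (symm3 t) (symm3 s) :=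
  h.kronecker (h.rotate.kronecker h.rotate.rotate)

variable [DecidableEq ι] [DecidableEq κ] [DecidableEq μ]

/-- `⊗_q (T_q ⊗ (T_q)_C ⊗ (T_q)_{C²}) ≥ (⊗_q T_q) ⊗ (⊗_q T_q)_C ⊗ (⊗_q T_q)_{C²}` (relabelling).
[cite: LeGall2014, Appendix A.3] -/
theorem tensorRestrictsTo_kroneckerPi_symm3 {N : ℕ} (T : Fin N → ι → κ → μ → K) :
    TensorRestrictsTo (kroneckerPi fun q => symm3 (T q)) (symm3 (kroneckerPi T)) := by
  classical
  -- split off the first factor, then the second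
  have h1 : TensorRestrictsTo (kroneckerPi fun q => symm3 (T q))
      (kroneckerTensor (kroneckerPi T)
        (kroneckerPi fun q => kroneckerTensor (rotate (T q)) (rotate (rotate (T q))))) := by
    rw [show (fun q => symm3 (T q)) = fun q => kroneckerTensor (T q)
      (kroneckerTensor (rotate (T q)) (rotate (rotate (T q)))) from rfl, kroneckerPi_kronecker_eq]
    exact tensorRestrictsTo_of_reindex _ _ _ _
  have h2 : TensorRestrictsTo (kroneckerPi fun q => kroneckerTensor (rotate (T q)) (rotate (rotate (T q))))
      (kroneckerTensor (kroneckerPi fun q => rotate (T q)) (kroneckerPi fun q => rotate (rotate (T q)))) := by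
    rw [kroneckerPi_kronecker_eq]
    exact tensorRestrictsTo_of_reindex _ _ _ _
  exact h1.trans ((TensorRestrictsTo.refl _).kronecker h2)

/-- Conversely `(⊗_q T_q) ⊗ (⊗_q T_q)_C ⊗ (⊗_q T_q)_{C²} ≥ ⊗_q (T_q ⊗ (T_q)_C ⊗ (T_q)_{C²})`.
[cite: LeGall2014, Appendix A.3] -/
theorem tensorRestrictsTo_symm3_kroneckerPi {N : ℕ} (T : Fin N → ι → κ → μ → K) :
    TensorRestrictsTo (symm3 (kroneckerPi T)) (kroneckerPi fun q => symm3 (T q)) := by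
  classical
  have h2 : TensorRestrictsTo
      (kroneckerTensor (kroneckerPi fun q => rotate (T q)) (kroneckerPi fun q => rotate (rotate (T q))))
      (kroneckerPi fun q => kroneckerTensor (rotate (T q)) (rotate (rotate (T q)))) := by
    rw [kroneckerPi_kronecker_eq (fun q => rotate (T q)) (fun q => rotate (rotate (T q)))]
    exact tensorRestrictsTo_precomp _ _ _ _
  have h1 : TensorRestrictsTo (kroneckerTensor (kroneckerPi T)
        (kroneckerPi fun q => kroneckerTensor (rotate (T q)) (rotate (rotate (T q)))))
      (kroneckerPi fun q => symm3 (T q)) := by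
    rw [show (fun q => symm3 (T q)) = fun q => kroneckerTensor (T q)
      (kroneckerTensor (rotate (T q)) (rotate (rotate (T q)))) from rfl,
      kroneckerPi_kronecker_eq T (fun q => kroneckerTensor (rotate (T q)) (rotate (rotate (T q))))]
    exact tensorRestrictsTo_precomp _ _ _ _
  exact ((TensorRestrictsTo.refl _).kronecker h2).trans h1

end Symm3

/-! ## Asymptotic rank of products and of the symmetrisation -/

section AsymptoticRank

variable {K : Type u} [Field K]
variable {ι κ μ ι' κ' μ' : Type*} [Fintype ι] [Fintype κ] [Fintype μ] [Fintype ι'] [Fintype κ']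
  [Fintype μ'] [DecidableEq ι] [DecidableEq κ] [DecidableEq μ] [DecidableEq ι'] [DecidableEq κ']
  [DecidableEq μ']

/-- **`R̃(s ⊗ t) ≤ R̃(s) · R̃(t)`** (`R((s⊗t)^{⊗n}) ≤ R(s^{⊗n}) R(t^{⊗n})` and the ranks of powers along
suitable subsequences are controlled by `R̃ + ε`). [folklore] -/
theorem asymptoticRank_kronecker_le (s : ι → κ → μ → K) (t : ι' → κ' → μ' → K) :
    asymptoticRank (kroneckerTensor s t) ≤ asymptoticRank s * asymptoticRank t := by
  classical
  have hs0 := asymptoticRank_nonneg s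
  have ht0 := asymptoticRank_nonneg t
  refine le_of_forall_pos_le_add fun ε hε => ?_
  -- a tolerance `δ` with `(R̃ s + δ)(R̃ t + δ) ≤ R̃ s R̃ t + ε`
  obtain ⟨δ, hδ, hδε⟩ : ∃ δ : ℝ, 0 < δ ∧
      (asymptoticRank s + δ) * (asymptoticRank t + δ) ≤ asymptoticRank s * asymptoticRank t + ε := by
    have hc : ContinuousAt (fun δ : ℝ => (asymptoticRank s + δ) * (asymptoticRank t + δ)) 0 :=
      ((continuous_const.add continuous_id).mul (continuous_const.add continuous_id)).continuousAt
    have hlt : (fun δ : ℝ => (asymptoticRank s + δ) * (asymptoticRank t + δ)) 0 <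
        asymptoticRank s * asymptoticRank t + ε := by simp [hε]
    obtain ⟨η, hη, hball⟩ := Metric.eventually_nhds_iff.1 (hc.eventually (Iio_mem_nhds hlt))
    refine ⟨η / 2, by positivity, le_of_lt (hball ?_)⟩
    rw [Real.dist_eq, sub_zero, abs_of_pos (by positivity)]; linarith
  obtain ⟨N₀, hN₀, hpowS⟩ := exists_tensorRank_kroneckerPow_mul_le s hδ
  obtain ⟨N₁, hN₁, hpowT⟩ := exists_tensorRank_kroneckerPow_mul_le t hδ
  -- at the common power `n = N₀ N₁`
  set n : ℕ := N₀ * N₁ with hn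
  have hn0 : 0 < n := Nat.mul_pos hN₀ hN₁
  have hR : (tensorRank (kroneckerPow (kroneckerTensor s t) n) : ℝ) ≤
      ((asymptoticRank s + δ) * (asymptoticRank t + δ)) ^ n := by
    have h1 : tensorRank (kroneckerPow (kroneckerTensor s t) n) ≤
        tensorRank (kroneckerPow s n) * tensorRank (kroneckerPow t n) :=
      (tensorRestrictsTo_kroneckerPow_kronecker s t n).tensorRank_le.trans (Blaser2013_lemma58 _ _)
    have h2 : (tensorRank (kroneckerPow s n) : ℝ) ≤ (asymptoticRank s + δ) ^ n := hpowS N₁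
    have h3 : (tensorRank (kroneckerPow t n) : ℝ) ≤ (asymptoticRank t + δ) ^ n := by
      have := hpowT N₀; rwa [Nat.mul_comm] at this
    calc (tensorRank (kroneckerPow (kroneckerTensor s t) n) : ℝ)
        ≤ (tensorRank (kroneckerPow s n) : ℝ) * tensorRank (kroneckerPow t n) := by exact_mod_cast h1
      _ ≤ (asymptoticRank s + δ) ^ n * (asymptoticRank t + δ) ^ n :=
          mul_le_mul h2 h3 (Nat.cast_nonneg _) (by positivity)
      _ = ((asymptoticRank s + δ) * (asymptoticRank t + δ)) ^ n := (mul_pow _ _ _).symm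
  have hA0 : 0 ≤ (asymptoticRank s + δ) * (asymptoticRank t + δ) := by positivity
  calc asymptoticRank (kroneckerTensor s t)
      ≤ (tensorRank (kroneckerPow (kroneckerTensor s t) n) : ℝ) ^ ((n : ℝ)⁻¹) :=
        Literature.Barriers.MatrixMultiplication.asymptoticRank_le_rpow _ hn0
    _ ≤ (((asymptoticRank s + δ) * (asymptoticRank t + δ)) ^ n) ^ ((n : ℝ)⁻¹) :=
        Real.rpow_le_rpow (Nat.cast_nonneg _) hR (inv_nonneg.2 (Nat.cast_nonneg _))
    _ = (asymptoticRank s + δ) * (asymptoticRank t + δ) := Real.pow_rpow_inv_natCast hA0 hn0.ne'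
    _ ≤ asymptoticRank s * asymptoticRank t + ε := hδε

/-- **`R̃(t ⊗ t_C ⊗ t_{C²}) ≤ R̃(t)³`** (`R̃(t_C) = R̃(t)`, `asymptoticRank_rotate`). [cite: LeGall2014, §2.2] -/
theorem asymptoticRank_symm3_le (t : ι → κ → μ → K) :
    asymptoticRank (symm3 t) ≤ asymptoticRank t ^ 3 := by
  have h0 := asymptoticRank_nonneg t
  have hr1 : asymptoticRank (rotate t) = asymptoticRank t :=
    Literature.Barriers.MatrixMultiplication.asymptoticRank_rotate t
  have hr2 : asymptoticRank (rotate (rotate t)) = asymptoticRank t := by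
    rw [Literature.Barriers.MatrixMultiplication.asymptoticRank_rotate, hr1]
  calc asymptoticRank (symm3 t) ≤ asymptoticRank t *
        asymptoticRank (kroneckerTensor (rotate t) (rotate (rotate t))) :=
        asymptoticRank_kronecker_le _ _
    _ ≤ asymptoticRank t * (asymptoticRank (rotate t) * asymptoticRank (rotate (rotate t))) :=
        mul_le_mul_of_nonneg_left (asymptoticRank_kronecker_le _ _) h0
    _ = asymptoticRank t ^ 3 := by rw [hr1, hr2]; ring

end AsymptoticRank

/-! ## The induced decomposition: labels, support, tightness -/

section Labels

variable {ι κ μ : Type*} {I J L : Type*}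

/-- `x`-labels of `t ⊗ t_C ⊗ t_{C²}`: `(x₁, x₂, x₃) ↦ (bI x₁, bJ x₂, bL x₃)`. [cite: LeGall2014, Appendix A.3 (definition of Λ)] -/
abbrev symLab₁ (bI : ι → I) (bJ : κ → J) (bL : μ → L) : ι × κ × μ → I × J × L :=
  fun x => (bI x.1, bJ x.2.1, bL x.2.2)

/-- `y`-labels of `t ⊗ t_C ⊗ t_{C²}`: `(y₁, y₂, y₃) ↦ (bJ y₁, bL y₂, bI y₃)`. [cite: LeGall2014, Appendix A.3 (definition of Λ)] -/
abbrev symLab₂ (bI : ι → I) (bJ : κ → J) (bL : μ → L) : κ × μ × ι → J × L × I :=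
  fun y => (bJ y.1, bL y.2.1, bI y.2.2)

/-- `z`-labels of `t ⊗ t_C ⊗ t_{C²}`: `(z₁, z₂, z₃) ↦ (bL z₁, bI z₂, bJ z₃)`. [cite: LeGall2014, Appendix A.3 (definition of Λ)] -/
abbrev symLab₃ (bI : ι → I) (bJ : κ → J) (bL : μ → L) : μ × ι × κ → L × I × J :=
  fun z => (bL z.1, bI z.2.1, bJ z.2.2)

/-- **Label triples of `t ⊗ t_C ⊗ t_{C²}` ↔ triples `(s¹, s², s³)` of labels of the three tensor
factors**: `s¹ = (X₁, Y₁, Z₁)` (the `t`-factor), `s² = (Z₂, X₂, Y₂)` (the `t_C`-factor, whose `x`-slot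
carries a `y`-label of `t`), `s³ = (Y₃, Z₃, X₃)` (the `t_{C²}`-factor) — Le Gall's
`u = (a, b′, c″), v = (b, c′, a″), w = (c, a′, b″)`. [cite: LeGall2014, Appendix A.3 (definition of Λ)] -/
def symLabelEquiv (I J L : Type*) :
    (I × J × L) × (J × L × I) × (L × I × J) ≃ (I × J × L) × (I × J × L) × (I × J × L) where
  toFun XYZ := ((XYZ.1.1, XYZ.2.1.1, XYZ.2.2.1), (XYZ.2.2.2.1, XYZ.1.2.1, XYZ.2.1.2.1),
    (XYZ.2.1.2.2, XYZ.2.2.2.2, XYZ.1.2.2))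
  invFun T := ((T.1.1, T.2.1.2.1, T.2.2.2.2), (T.1.2.1, T.2.1.2.2, T.2.2.1),
    (T.1.2.2, T.2.1.1, T.2.2.2.1))
  left_inv := by
    rintro ⟨⟨a, b, c⟩, ⟨d, e, f⟩, ⟨g, h, i⟩⟩
    rfl
  right_inv := by
    rintro ⟨⟨a, b, c⟩, ⟨d, e, f⟩, ⟨g, h, i⟩⟩
    rfl

/-- Unfolding of `symLabelEquiv`. [folklore] -/
@[simp] theorem symLabelEquiv_apply (XYZ : (I × J × L) × (J × L × I) × (L × I × J)) :
    symLabelEquiv I J L XYZ = ((XYZ.1.1, XYZ.2.1.1, XYZ.2.2.1),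
      (XYZ.2.2.2.1, XYZ.1.2.1, XYZ.2.1.2.1), (XYZ.2.1.2.2, XYZ.2.2.2.2, XYZ.1.2.2)) := rfl

/-- Unfolding of `symLabelEquiv.symm`. [folklore] -/
@[simp] theorem symLabelEquiv_symm_apply (T : (I × J × L) × (I × J × L) × (I × J × L)) :
    (symLabelEquiv I J L).symm T = ((T.1.1, T.2.1.2.1, T.2.2.2.2), (T.1.2.1, T.2.1.2.2, T.2.2.1),
      (T.1.2.2, T.2.1.1, T.2.2.2.1)) := rfl

variable [Fintype I] [Fintype J] [Fintype L] [DecidableEq I] [DecidableEq J] [DecidableEq L]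

/-- **The induced support** `Λ`-pattern of `t ⊗ t_C ⊗ t_{C²}`: the label triples whose three factor
labels all lie in `S` (`= S × S × S` through `symLabelEquiv`). [cite: LeGall2014, Appendix A.3 (definition of Λ)] -/
def symSupport (S : Finset (I × J × L)) : Finset ((I × J × L) × (J × L × I) × (L × I × J)) :=
  Finset.univ.filter fun XYZ => (symLabelEquiv I J L XYZ).1 ∈ S ∧
    (symLabelEquiv I J L XYZ).2.1 ∈ S ∧ (symLabelEquiv I J L XYZ).2.2 ∈ S

/-- Membership in the induced support. [folklore] -/
theorem mem_symSupport {S : Finset (I × J × L)} {XYZ : (I × J × L) × (J × L × I) × (L × I × J)} :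
    XYZ ∈ symSupport S ↔ (symLabelEquiv I J L XYZ).1 ∈ S ∧
      (symLabelEquiv I J L XYZ).2.1 ∈ S ∧ (symLabelEquiv I J L XYZ).2.2 ∈ S := by
  simp [symSupport]

/-- `symLabelEquiv.symm (s¹,s²,s³)` lies in the induced support iff `s¹, s², s³ ∈ S`. [folklore] -/
theorem symm_mem_symSupport {S : Finset (I × J × L)} {T : (I × J × L) × (I × J × L) × (I × J × L)} :
    (symLabelEquiv I J L).symm T ∈ symSupport S ↔ T.1 ∈ S ∧ T.2.1 ∈ S ∧ T.2.2 ∈ S := by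
  rw [mem_symSupport, Equiv.apply_symm_apply]

variable {K : Type u} [CommSemiring K]

/-- **The support of `t ⊗ t_C ⊗ t_{C²}` is contained in the induced support** of any `S ⊇ supp_D t`.
[cite: LeGall2014, Appendix A.3] -/
theorem symm3_support (t : ι → κ → μ → K) (bI : ι → I) (bJ : κ → J) (bL : μ → L)
    (S : Finset (I × J × L)) (hS : ∀ a b c, t a b c ≠ 0 → (bI a, bJ b, bL c) ∈ S)
    (x : ι × κ × μ) (y : κ × μ × ι) (z : μ × ι × κ) (h : symm3 t x y z ≠ 0) :
    (symLab₁ bI bJ bL x, symLab₂ bI bJ bL y, symLab₃ bI bJ bL z) ∈ symSupport S := by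
  rw [symm3_apply] at h
  have h1 : t x.1 y.1 z.1 ≠ 0 := fun h0 => h (by rw [h0, zero_mul])
  have h2 : t z.2.1 x.2.1 y.2.1 ≠ 0 := fun h0 => h (by rw [h0, zero_mul, mul_zero])
  have h3 : t y.2.2 z.2.2 x.2.2 ≠ 0 := fun h0 => h (by rw [h0, mul_zero, mul_zero])
  rw [mem_symSupport]
  exact ⟨hS _ _ _ h1, hS _ _ _ h2, hS _ _ _ h3⟩

end Labels

/-! ## Tightness of the induced support -/

section Tight

variable {I J L : Type*} {r : ℕ}

/-- Tightness vectors for the `x`-labels: concatenate `α(X₁), β(X₂), γ(X₃)`.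
[cite: LeGall2014, Appendix A.3] -/
def symTight₁ (α : I → Fin r → ℤ) (β : J → Fin r → ℤ) (γ : L → Fin r → ℤ) :
    I × J × L → Fin (r + r + r) → ℤ :=
  fun X => Fin.append (Fin.append (α X.1) (β X.2.1)) (γ X.2.2)

/-- Tightness vectors for the `y`-labels: concatenate `β(Y₁), γ(Y₂), α(Y₃)`.
[cite: LeGall2014, Appendix A.3] -/
def symTight₂ (α : I → Fin r → ℤ) (β : J → Fin r → ℤ) (γ : L → Fin r → ℤ) :
    J × L × I → Fin (r + r + r) → ℤ :=
  fun Y => Fin.append (Fin.append (β Y.1) (γ Y.2.1)) (α Y.2.2)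

/-- Tightness vectors for the `z`-labels: concatenate `γ(Z₁), α(Z₂), β(Z₃)`.
[cite: LeGall2014, Appendix A.3] -/
def symTight₃ (α : I → Fin r → ℤ) (β : J → Fin r → ℤ) (γ : L → Fin r → ℤ) :
    L × I × J → Fin (r + r + r) → ℤ :=
  fun Z => Fin.append (Fin.append (γ Z.1) (α Z.2.1)) (β Z.2.2)

/-- Components of a double `Fin.append` are recovered from it. [folklore] -/
theorem append_append_inj {u u' v v' w w' : Fin r → ℤ}
    (h : Fin.append (Fin.append u v) w = Fin.append (Fin.append u' v') w') :
    u = u' ∧ v = v' ∧ w = w' := by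
  refine ⟨funext fun k => ?_, funext fun k => ?_, funext fun k => ?_⟩
  · have := congrFun h (Fin.castAdd r (Fin.castAdd r k))
    simpa only [Fin.append_left] using this
  · have := congrFun h (Fin.castAdd r (Fin.natAdd r k))
    simpa only [Fin.append_left, Fin.append_right] using this
  · have := congrFun h (Fin.natAdd (r + r) k)
    simpa only [Fin.append_right] using this

/-- A double `Fin.append` of vectors bounded by `b` is bounded by `b`. [folklore] -/
theorem abs_append_append_le {u v w : Fin r → ℤ} {b : ℕ} (hu : ∀ k, |u k| ≤ b) (hv : ∀ k, |v k| ≤ b)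
    (hw : ∀ k, |w k| ≤ b) (k : Fin (r + r + r)) :
    |Fin.append (Fin.append u v) w k| ≤ b := by
  refine Fin.addCases (fun k => ?_) (fun k => ?_) k
  · rw [Fin.append_left]
    refine Fin.addCases (fun k => ?_) (fun k => ?_) k
    · rw [Fin.append_left]; exact hu k
    · rw [Fin.append_right]; exact hv k
  · rw [Fin.append_right]; exact hw k

/-- `symTight₁` is injective when `α, β, γ` are. [folklore] -/
theorem symTight₁_injective {α : I → Fin r → ℤ} {β : J → Fin r → ℤ} {γ : L → Fin r → ℤ}
    (hα : Function.Injective α) (hβ : Function.Injective β) (hγ : Function.Injective γ) :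
    Function.Injective (symTight₁ α β γ) := by
  intro X X' h
  obtain ⟨h1, h2, h3⟩ := append_append_inj h
  exact Prod.ext (hα h1) (Prod.ext (hβ h2) (hγ h3))

/-- `symTight₂` is injective when `α, β, γ` are. [folklore] -/
theorem symTight₂_injective {α : I → Fin r → ℤ} {β : J → Fin r → ℤ} {γ : L → Fin r → ℤ}
    (hα : Function.Injective α) (hβ : Function.Injective β) (hγ : Function.Injective γ) :
    Function.Injective (symTight₂ α β γ) := by
  intro Y Y' h
  obtain ⟨h1, h2, h3⟩ := append_append_inj h
  exact Prod.ext (hβ h1) (Prod.ext (hγ h2) (hα h3))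

/-- `symTight₃` is injective when `α, β, γ` are. [folklore] -/
theorem symTight₃_injective {α : I → Fin r → ℤ} {β : J → Fin r → ℤ} {γ : L → Fin r → ℤ}
    (hα : Function.Injective α) (hβ : Function.Injective β) (hγ : Function.Injective γ) :
    Function.Injective (symTight₃ α β γ) := by
  intro Z Z' h
  obtain ⟨h1, h2, h3⟩ := append_append_inj h
  exact Prod.ext (hγ h1) (Prod.ext (hα h2) (hβ h3))

/-- `symTight₁` is bounded by `b`. [folklore] -/
theorem symTight₁_bound {α : I → Fin r → ℤ} {β : J → Fin r → ℤ} {γ : L → Fin r → ℤ} {b : ℕ}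
    (hα : ∀ i k, |α i k| ≤ b) (hβ : ∀ j k, |β j k| ≤ b) (hγ : ∀ l k, |γ l k| ≤ b)
    (X : I × J × L) (k : Fin (r + r + r)) : |symTight₁ α β γ X k| ≤ b :=
  abs_append_append_le (hα _) (hβ _) (hγ _) k

/-- `symTight₂` is bounded by `b`. [folklore] -/
theorem symTight₂_bound {α : I → Fin r → ℤ} {β : J → Fin r → ℤ} {γ : L → Fin r → ℤ} {b : ℕ}
    (hα : ∀ i k, |α i k| ≤ b) (hβ : ∀ j k, |β j k| ≤ b) (hγ : ∀ l k, |γ l k| ≤ b)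
    (Y : J × L × I) (k : Fin (r + r + r)) : |symTight₂ α β γ Y k| ≤ b :=
  abs_append_append_le (hβ _) (hγ _) (hα _) k

/-- **Tightness of the induced support**: on `symSupport S` the three vectors sum to zero (each
block of coordinates is the tightness relation of one of `s¹, s², s³ ∈ S`).
[cite: LeGall2014, Appendix A.3] -/
theorem symTight_sum [Fintype I] [Fintype J] [Fintype L] [DecidableEq I] [DecidableEq J]
    [DecidableEq L] {α : I → Fin r → ℤ} {β : J → Fin r → ℤ} {γ : L → Fin r → ℤ}
    (S : Finset (I × J × L)) (htight : ∀ s ∈ S, ∀ k, α s.1 k + β s.2.1 k + γ s.2.2 k = 0)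
    (XYZ : (I × J × L) × (J × L × I) × (L × I × J)) (hXYZ : XYZ ∈ symSupport S)
    (k : Fin (r + r + r)) :
    symTight₁ α β γ XYZ.1 k + symTight₂ α β γ XYZ.2.1 k + symTight₃ α β γ XYZ.2.2 k = 0 := by
  obtain ⟨h1, h2, h3⟩ := mem_symSupport.1 hXYZ
  simp only [symTight₁, symTight₂, symTight₃]
  refine Fin.addCases (fun k => ?_) (fun k => ?_) k
  · simp only [Fin.append_left]
    refine Fin.addCases (fun k => ?_) (fun k => ?_) k
    · simp only [Fin.append_left]
      exact htight _ h1 k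
    · simp only [Fin.append_right]
      have := htight _ h2 k
      simp only [symLabelEquiv_apply] at this
      linarith
  · simp only [Fin.append_right]
    have := htight _ h3 k
    simp only [symLabelEquiv_apply] at this
    linarith

end Tight

/-! ## The components of the induced decomposition -/

section Components

variable {K : Type u} [CommSemiring K]
variable {ι κ μ : Type*} {I J L : Type*} [DecidableEq I] [DecidableEq J] [DecidableEq L]

/-- **The components of the induced decomposition of `t ⊗ t_C ⊗ t_{C²}` are
`t(s¹) ⊗ t(s²)_C ⊗ t(s³)_{C²}`** (Le Gall (6), at `N = 1`): the zero-out of `symm3 t` to the block with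
label triple `symLabelEquiv.symm (s¹, s², s³)` is the symmetrised product of the three components
`t(s) = partSubtensor bI bJ bL t {i} {j} {l}`. [cite: LeGall2014, Appendix A.3, Eq. (6)] -/
theorem partSubtensor_symm3 (t : ι → κ → μ → K) (bI : ι → I) (bJ : κ → J) (bL : μ → L)
    (T : (I × J × L) × (I × J × L) × (I × J × L)) :
    partSubtensor (symLab₁ bI bJ bL) (symLab₂ bI bJ bL) (symLab₃ bI bJ bL) (symm3 t)
        {((symLabelEquiv I J L).symm T).1} {((symLabelEquiv I J L).symm T).2.1}
        {((symLabelEquiv I J L).symm T).2.2} =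
      kroneckerTensor (partSubtensor bI bJ bL t {T.1.1} {T.1.2.1} {T.1.2.2})
        (kroneckerTensor (rotate (partSubtensor bI bJ bL t {T.2.1.1} {T.2.1.2.1} {T.2.1.2.2}))
          (rotate (rotate (partSubtensor bI bJ bL t {T.2.2.1} {T.2.2.2.1} {T.2.2.2.2})))) := by
  funext x y z
  simp only [partSubtensor_apply, Finset.mem_singleton, kroneckerTensor_apply,
    rotate_apply, symLabelEquiv_symm_apply, Prod.mk.injEq]
  by_cases h1 : bI x.1 = T.1.1 ∧ bJ y.1 = T.1.2.1 ∧ bL z.1 = T.1.2.2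
  · by_cases h2 : bI z.2.1 = T.2.1.1 ∧ bJ x.2.1 = T.2.1.2.1 ∧ bL y.2.1 = T.2.1.2.2
    · by_cases h3 : bI y.2.2 = T.2.2.1 ∧ bJ z.2.2 = T.2.2.2.1 ∧ bL x.2.2 = T.2.2.2.2
      · rw [if_pos h1, if_pos h2, if_pos h3, if_pos]
        exact ⟨⟨h1.1, h2.2.1, h3.2.2⟩, ⟨h1.2.1, h2.2.2, h3.1⟩, ⟨h1.2.2, h2.1, h3.2.1⟩⟩
      · rw [if_neg h3, if_neg, mul_zero, mul_zero]
        exact fun H => h3 ⟨H.2.1.2.2, H.2.2.2.2, H.1.2.2⟩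
    · rw [if_neg h2, if_neg, zero_mul, mul_zero]
      exact fun H => h2 ⟨H.2.2.2.1, H.1.2.1, H.2.1.2.1⟩
  · rw [if_neg h1, if_neg, zero_mul]
    exact fun H => h1 ⟨H.1.1, H.2.1.1, H.2.2.1⟩

end Components

end Literature.Computability.AlgebraicComplexity
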